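import Summits.HodgeConjecture.HodgeConjecture.Theses.LinearSystemTorelli

/-!
# `UnsupportedHodgeClassFourfold` refutes the summit: the negative side of route LinearSystemTorelli

Route `LinearSystemTorelli`, item `stmt-HodgeConjecture-2413` (`UnsupportedHodgeClassFourfold`, the
NEGATIVE SIDE of the crux `MiddleDivisorSupportFourfold` = item `stmt-HodgeConjecture-2409`, filed "so
refuters have a typed target").

This helper file records, kernel-checked, where the item sits logically:

* `UnsupportedHodgeClassFourfold ↔ ¬ MiddleDivisorSupportFourfold` (by definition);
* `HodgeConjecture → MiddleDivisorSupportFourfold`: a rational `(2,2)`-class that is algebraic lies in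
  `algebraicClasses X 2 = N² H⁴ ⊆ N¹ H⁴ = supportedClasses X 4 1` (the support filtration is
  decreasing, `supportedClasses_mono`);
* hence `UnsupportedHodgeClassFourfold → ¬ HodgeConjecture`: a proof of the item is a disproof of the
  summit statement (Thomas 2005, Thm. 1: a rational `(p,p)`-class in the middle degree is algebraic iff
  it is supported on a (nodal) hypersurface section, granted the conjecture one dimension down);
* and `UnsupportedHodgeClassFourfold → ¬ MiddleDivisorSupport` (the `p = 2` instance of the shared
  statement), so with the glue `SupportedOfTranscendentalOrSupported` it also negates the route's
  thesis `TranscendentalOrSupported`.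

No new definitions; pure logic over the route declarations and `supportedClasses_mono`.
-/

namespace Summit.HodgeConjecture.HodgeConjecture.Theorems

open Summit.HodgeConjecture.HodgeConjecture.Theses.LinearSystemTorelli

/-- The negative-side item unfolds to the negation of the fourfold crux (definitional).
[cite: Thomas2005Nodes, Thm. 1] -/
theorem linearSystemTorelli_unsupportedHodgeClassFourfold_iff :
    UnsupportedHodgeClassFourfold ↔ ¬ MiddleDivisorSupportFourfold :=
  Iff.rfl

/-- The fourfold crux is the `p = 2` instance of the shared middle-degree divisor-support statement
`MiddleDivisorSupport` (`2 * 2 = 4` definitionally). [cite: Thomas2005Nodes, Thm. 1] -/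
theorem linearSystemTorelli_middleDivisorSupportFourfold_of_middleDivisorSupport
    (h : MiddleDivisorSupport) : MiddleDivisorSupportFourfold :=
  fun _X hX c hc hh => h (p := 2) (by norm_num) hX c hc hh

/-- The Hodge conjecture implies the fourfold crux: an algebraic class lies in
`algebraicClasses X 2 = N² H⁴(X(ℂ); ℂ)`, and `N² ⊆ N¹` because the support (coniveau) filtration is
decreasing (`supportedClasses_mono`). [cite: GrothendieckTopology1969, §1] -/
theorem linearSystemTorelli_middleDivisorSupportFourfold_of_hodgeConjecture
    (h : _root_.HodgeConjecture) : MiddleDivisorSupportFourfold := by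
  intro X hX c hc hh
  have h2 : c ∈ Literature.AlgebraicGeometry.HodgeTheory.algebraicClasses X 2 := (h hX).2 2 c hc hh
  exact Literature.AlgebraicGeometry.HodgeTheory.supportedClasses_mono X 4 (by norm_num : 1 ≤ 2) h2

/-- **A proof of the item `UnsupportedHodgeClassFourfold` is a disproof of the summit statement
`HodgeConjecture`.** [cite: Thomas2005Nodes, Thm. 1] -/
theorem linearSystemTorelli_not_hodgeConjecture_of_unsupportedHodgeClassFourfold
    (h : UnsupportedHodgeClassFourfold) : ¬ _root_.HodgeConjecture :=
  fun hHC => h (linearSystemTorelli_middleDivisorSupportFourfold_of_hodgeConjecture hHC)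

/-- Contrapositive form: under the Hodge conjecture the negative-side item is false.
[cite: Thomas2005Nodes, Thm. 1] -/
theorem linearSystemTorelli_not_unsupportedHodgeClassFourfold_of_hodgeConjecture
    (hHC : _root_.HodgeConjecture) : ¬ UnsupportedHodgeClassFourfold :=
  fun h => linearSystemTorelli_not_hodgeConjecture_of_unsupportedHodgeClassFourfold h hHC

/-- The negative-side item negates the shared statement `MiddleDivisorSupport` (its `p = 2` instance
fails). [cite: Thomas2005Nodes, Thm. 1] -/
theorem linearSystemTorelli_not_middleDivisorSupport_of_unsupportedHodgeClassFourfold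
    (h : UnsupportedHodgeClassFourfold) : ¬ MiddleDivisorSupport :=
  fun hM => h (linearSystemTorelli_middleDivisorSupportFourfold_of_middleDivisorSupport hM)

/-- Given the glue item `SupportedOfTranscendentalOrSupported`, the negative-side item negates the
route's thesis `TranscendentalOrSupported` (kill criterion (i) of the route).
[cite: GrothendieckTopology1969, §1] -/
theorem linearSystemTorelli_not_transcendentalOrSupported_of_unsupportedHodgeClassFourfold
    (h : UnsupportedHodgeClassFourfold) (hS : SupportedOfTranscendentalOrSupported) :
    ¬ TranscendentalOrSupported :=
  fun hT => linearSystemTorelli_not_middleDivisorSupport_of_unsupportedHodgeClassFourfold h (hS hT)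

end Summit.HodgeConjecture.HodgeConjecture.Theorems
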